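/-
Copyright (c) 2026 the pub-hodgecm-mathlib formalisation cell (harness21).  Prover seat hodgecm-mathlib-LH4-p14 (g6), 2026-09-04 — STAGE-1b (β-BAL) road: brick (β-BAL-3) = B3,
FILE 4 — the `j = 0` (conic) count, ANISOTROPIC case in BOTH sign patterns, by the MÖBIUS INVOLUTION (SIG-B3D.v1∕v2; F0P3-p01 (g36) B3D-TABLE (T2) + MOBIUS-FLIP a269fed5).
-/
import Literature.NumberTheory.LocalFields.WildQuadraticDatumNormSignConductor   -- ★ (LH4-p06 (g3)) the ω-conductor toolkit
import HarnessLib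

/-!
# Crux `H413`, line LH4 «(D-RAM) FOUR-FRAME», STAGE-1b (β-BAL) — B3 FILE 4: THE ANISOTROPIC CONIC COUNT VANISHES (both sign patterns) — the Möbius involution of the quaternion
# division algebra `(K∕F, c)`

Cell `hodgecm-mathlib` (D-0151), FLOOR 0, crux item H413 = `stmt-HodgeConjecture-24833`, route `HCCMUnconditional`; squad LH4; lane `--supports stmt-HodgeConjecture-24833 --as helper`.
ONE THEOREM (+ two exact identities), no `def`, no `sorry`, default heartbeats; pure local arithmetic; COUNT-NEUTRAL.  Carrier = FILES 1–3 (LH4-p11 (g8) (Q2)).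

WHAT.  `S_0(s) = Σ_{r ∈ R, |r| = 1} ω(C₀ + C₁·N r)`, `c := −C₀∕C₁` NOT a norm (anisotropic).  ★ FILE 3 (D⁻) killed `S_0` with `n ↦ c²∕n`, which flips `ω` only when `ω(−c) = −1`.
F0P3-p01 (g36)'s engine table (B3D-TABLE.v1 (T2)) shows `S_0 = 0` in BOTH anisotropic patterns; the mechanism (SIG-B3D.v1 §2, confirmed numerically by g36 13:56:15Z as a MÖBIUS MAP):
`N x − c·N y` is the reduced norm of the quaternion DIVISION algebra `(K∕F, c)`, and left multiplication by `u = a + b·j` of NON-norm reduced norm `Nrd u = N a − c·N b`, renormalised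
to the slice `y = 1`, is the Möbius map **`φ(r) = (a·r + b·c) ∕ (σb·r + σa)`** with the EXACT identity **`N(φ r) − c = Nrd(u)·(N r − c) ∕ N(σb·r + σa)`** — so `ω` flips at EVERY
`r` (`ω(Nrd u) = −1`, `ω(N(…)) = +1`) — and `φ r − φ r′ = Nrd(u)·(r − r′) ∕ ((σb r + σa)(σb r′ + σa))`, an isometry on the units when `|a| = 1`, `|b| ≤ |ϖ|` (so `r ↦ rep(φ r)`
permutes the unit classes of `R`).  Hence:
* `sum_units_normSign_binaryNormForm_zero_eq_zero_of_anisotropic (hani : c ∉ N) (ha : |a| = 1) (hb : |b| ≤ |ϖ|) (hnrd : Nrd u ∉ N) (4d ≤ s + 3) : S_0(s) = 0`.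
The datum `(a, b)` is a HYPOTHESIS (in all five dyadic fields of the table `a = 1`, `b = ϖ` works — g36; in general its existence is the surjectivity of the reduced norm of a local
quaternion division algebra onto `F^×`, not typed here).
HONEST LABEL.  Count-neutral; (β-BAL), (β), T₊ stay OPEN; HC_CM is proved only modulo the 7 printed citations (2 remaining named inputs: hLiu418 = `stmt-HodgeConjecture-24832`,
h413 = `stmt-HodgeConjecture-24833`) until rung 0 closes.

## References
* [Serre1979] J.-P. Serre, *Local Fields*, GTM 67 (1979) — Ch. V §3 Prop. 5, Cor. 2–3, Ch. XV §2; Ch. XIII §5 (local quaternion algebras).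
* [NeukirchANT1999] J. Neukirch, *Algebraic Number Theory* (1999) — Ch. V (1.3).
-/

set_option autoImplicit false

noncomputable section

namespace Summit.HodgeConjecture.HodgeConjecture.Cruxes.H413.F0P3cDyRamBinaryNormFormConicAnisotropic

open WithZero
open scoped Valued
open Literature.NumberTheory.Automorphic.UnitaryThreeFourFrame
open Literature.NumberTheory.LocalFields.WildQuadraticDatum

variable {K : Type} [Field K] [Valued K ℤᵐ⁰] {σ : K →+* K} {ϖ : K} {d t : ℕ}

omit [Valued K ℤᵐ⁰] in
/-- **THE MÖBIUS NORM IDENTITY** (exact algebra; `σ` enters only through the paired variables): with `x := (a r + b c)∕(bs r + as)` and `xs := (as rs + bs c)∕(b rs + a)`,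
`x·xs − c = (a·as − c·b·bs)·(r·rs − c) ∕ ((bs r + as)(b rs + a))`. [cite: Serre1979, Ch. XIII §5] -/
theorem mobius_norm_identity {a as b bs c r rs : K} (h1 : bs * r + as ≠ 0) (h2 : b * rs + a ≠ 0) :
    (a * r + b * c) / (bs * r + as) * ((as * rs + bs * c) / (b * rs + a)) - c =
      (a * as - c * (b * bs)) * (r * rs - c) / ((bs * r + as) * (b * rs + a)) := by
  rw [div_mul_div_comm, eq_div_iff (mul_ne_zero h1 h2), sub_mul, div_mul_cancel₀ _ (mul_ne_zero h1 h2)]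
  ring

omit [Valued K ℤᵐ⁰] in
/-- **THE MÖBIUS DIFFERENCE IDENTITY**: `x(r) − x(r′) = (a·as − b·bs·c)(r − r′) ∕ ((bs r + as)(bs r′ + as))`. [cite: Serre1979, Ch. XIII §5] -/
theorem mobius_sub_identity {a as b bs c r r' : K} (h1 : bs * r + as ≠ 0) (h2 : bs * r' + as ≠ 0) :
    (a * r + b * c) / (bs * r + as) - (a * r' + b * c) / (bs * r' + as) = (a * as - c * (b * bs)) * (r - r') / ((bs * r + as) * (bs * r' + as)) := by
  rw [div_sub_div _ _ h1 h2, div_eq_div_iff (mul_ne_zero h1 h2) (mul_ne_zero h1 h2)]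
  ring

/-- **(D-aniso) THE ANISOTROPIC CONIC COUNT VANISHES — BOTH SIGN PATTERNS.**  Ramified datum on a complete `K` with finite residue field; `C₀, C₁` fixed units with `c := −C₀∕C₁` NOT a
norm; `a, b ∈ K` with `|a| = 1`, `|b| ≤ |ϖ|` and `Nrd := N a − c·N b` NOT a norm; `R` a complete irredundant residue system modulo `ϖ^s`, `4d ≤ s + 3`.  Then
**`Σ_{r ∈ R, |r| = 1} ω(C₀ + C₁·N r) = 0`** — by the Möbius involution `r ↦ rep((a r + b c)∕(σb r + σa))` (see the module docstring). [cite: Serre1979, Ch. V §3 Cor. 3; Ch. XIII §5; Ch. XV §2] -/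
theorem sum_units_normSign_binaryNormForm_zero_eq_zero_of_anisotropic [CompleteSpace K] [Finite 𝓀[K]] (hD : IsRamifiedQuadraticDatum σ ϖ d t)
    {C₀ C₁ : K} (hσC₀ : σ C₀ = C₀) (hC₀ : Valued.v C₀ = 1) (hσC₁ : σ C₁ = C₁) (hC₁ : Valued.v C₁ = 1)
    (hani : ¬ ∃ z : K, z * σ z = -(C₀ / C₁))
    {a b : K} (ha : Valued.v a = 1) (hb : Valued.v b ≤ Valued.v ϖ) (hnrd : ¬ ∃ z : K, z * σ z = a * σ a - (-(C₀ / C₁)) * (b * σ b))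
    {s : ℕ} (hs : 4 * d ≤ s + 3)
    (R : Finset K) (_hR₁ : ∀ r ∈ R, Valued.v r ≤ 1) (hR₂ : ∀ x : K, Valued.v x ≤ 1 → ∃ r ∈ R, Valued.v (x - r) ≤ Valued.v ϖ ^ s)
    (hR₃ : ∀ r ∈ R, ∀ r' ∈ R, Valued.v (r - r') ≤ Valued.v ϖ ^ s → r = r') :
    ∑ r ∈ R with Valued.v r = 1, normSign σ (C₀ + C₁ * (r * σ r)) = 0 := by
  classical
  obtain ⟨hσ, hvσ, hϖ, hfix, -, hd1, -⟩ := id hD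
  have hϖ0' : Valued.v ϖ ≠ 0 := by rw [hϖ]; exact exp_ne_zero
  have hϖ1 : Valued.v ϖ ≤ 1 := by rw [hϖ, ← exp_zero]; exact exp_le_exp.2 (by norm_num)
  have hϖlt : Valued.v ϖ < 1 := by rw [hϖ, ← exp_zero]; exact exp_lt_exp.2 (by norm_num)
  have hC₁0 : C₁ ≠ 0 := fun h => by rw [h, map_zero] at hC₁; exact zero_ne_one hC₁
  have hC₀0 : C₀ ≠ 0 := fun h => by rw [h, map_zero] at hC₀; exact zero_ne_one hC₀
  have hq0 : C₀ / C₁ ≠ 0 := div_ne_zero hC₀0 hC₁0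
  have hσq : σ (C₀ / C₁) = C₀ / C₁ := by rw [map_div₀, hσC₀, hσC₁]
  have hvq : Valued.v (C₀ / C₁) = 1 := by rw [map_div₀, hC₀, hC₁, div_one]
  set c : K := -(C₀ / C₁) with hc
  have hσc : σ c = c := by rw [hc, map_neg, hσq]
  have hvc : Valued.v c = 1 := by rw [hc, Valuation.map_neg, hvq]
  have hc0 : c ≠ 0 := neg_ne_zero.2 hq0
  set Ru := R.filter (fun r => Valued.v r = 1) with hRu
  have hNσ : ∀ r : K, σ (r * σ r) = r * σ r := fun r => by rw [map_mul, hσ, mul_comm]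
  have hN1 : ∀ r : K, Valued.v r = 1 → Valued.v (r * σ r) = 1 := fun r hr => by rw [map_mul, hvσ, hr, mul_one]
  have hy : ∀ r : K, C₀ + C₁ * (r * σ r) = C₁ * (r * σ r - c) := fun r => by rw [hc]; field_simp; ring
  have hσy : ∀ r : K, σ (C₀ + C₁ * (r * σ r)) = C₀ + C₁ * (r * σ r) := fun r => by rw [map_add, hσC₀, map_mul, hσC₁, hNσ]
  -- ANISOTROPY: `|N r − c| ≥ |ϖ|^{2d−2}` for every unit `r`
  have hfar : ∀ r : K, Valued.v r = 1 → Valued.v ϖ ^ (2 * d - 2) ≤ Valued.v (r * σ r - c) := by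
    intro r hr
    by_contra hlt
    rw [not_le] at hlt
    have hσw : σ (r * σ r - c) = r * σ r - c := by rw [map_sub, hNσ, hσc]
    have hle : Valued.v (r * σ r - c) ≤ Valued.v ϖ ^ (2 * d - 1) := by
      by_cases h0 : r * σ r - c = 0
      · rw [h0, map_zero]; exact zero_le
      · obtain ⟨n, hn⟩ := hfix _ hσw h0
        rw [hn] at hlt ⊢
        rw [hϖ, ← exp_nsmul, nsmul_eq_mul] at hlt ⊢
        have h1 := exp_lt_exp.1 hlt
        exact exp_le_exp.2 (by omega)
    have hN0 : r * σ r ≠ 0 := fun h => by have := hN1 r hr; rw [h, map_zero] at this; exact zero_ne_one this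
    have hr0 : r ≠ 0 := fun h => by rw [h, map_zero] at hr; exact zero_ne_one hr
    have hσr0 : σ r ≠ 0 := (map_ne_zero σ).2 hr0
    have hσu : σ (c / (r * σ r)) = c / (r * σ r) := by rw [map_div₀, hσc, hNσ]
    have hu1 : Valued.v (c / (r * σ r) - 1) ≤ Valued.v ϖ ^ (2 * d - 1) := by
      have e1 : c / (r * σ r) - 1 = -((r * σ r - c) / (r * σ r)) := by field_simp; ring
      rw [e1, Valuation.map_neg, map_div₀, hN1 r hr, div_one]
      exact hle
    obtain ⟨z, hz⟩ := exists_mul_map_eq_of_fixed_of_v_sub_one_le_pred hD hσu le_rfl hu1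
    refine hani ⟨z * r, ?_⟩
    rw [map_mul]
    calc z * r * (σ z * σ r) = (z * σ z) * (r * σ r) := by ring
      _ = c := by rw [hz, div_mul_cancel₀ _ hN0]
  have hy0 : ∀ r : K, Valued.v r = 1 → C₀ + C₁ * (r * σ r) ≠ 0 := fun r hr h => by
    have h2 := hfar r hr
    rw [hy] at h
    rw [(mul_eq_zero.1 h).resolve_left hC₁0, map_zero, le_zero_iff] at h2
    exact pow_ne_zero _ hϖ0' h2
  -- THE QUATERNION DATA: `Nrd = N a − c·N b` (fixed non-norm unit), the Möbius map `x r = (a r + b c)∕(σb r + σa)`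
  set Nrd : K := a * σ a - c * (b * σ b) with hNrd
  have hnrd' : ¬ ∃ z : K, z * σ z = Nrd := by rwa [hNrd]
  have hσNrd : σ Nrd = Nrd := by rw [hNrd, map_sub, map_mul, map_mul, map_mul, hσ, hσ, hσc]; ring
  have hbσb : Valued.v (c * (b * σ b)) < 1 := by
    rw [map_mul, hvc, one_mul, map_mul, hvσ]
    calc Valued.v b * Valued.v b ≤ Valued.v ϖ * Valued.v ϖ := mul_le_mul' hb hb
      _ < 1 := mul_lt_one_of_lt_of_le hϖlt hϖ1
  have hvNrd : Valued.v Nrd = 1 := by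
    have haa : Valued.v (a * σ a) = 1 := by rw [map_mul, hvσ, ha, mul_one]
    rw [hNrd, Valuation.map_sub_eq_of_lt_left _ (by rwa [haa]), haa]
  have hNrd0 : Nrd ≠ 0 := fun h => by rw [h, map_zero] at hvNrd; exact zero_ne_one hvNrd
  have hDen1 : ∀ r : K, Valued.v r = 1 → Valued.v (σ b * r + σ a) = 1 := by
    intro r hr
    have hlt : Valued.v (σ b * r) < Valued.v (σ a) := by
      rw [map_mul, hvσ, hr, mul_one, hvσ, ha]; exact lt_of_le_of_lt hb hϖlt
    rw [add_comm, Valuation.map_add_eq_of_lt_left _ hlt, hvσ, ha]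
  have hDen0 : ∀ r : K, Valued.v r = 1 → σ b * r + σ a ≠ 0 := fun r hr h => by
    have := hDen1 r hr; rw [h, map_zero] at this; exact zero_ne_one this
  have hDen0' : ∀ r : K, Valued.v r = 1 → b * σ r + a ≠ 0 := by
    intro r hr h
    have h' : σ (σ b * r + σ a) = 0 := by rw [map_add, map_mul, hσ, hσ, h]
    exact hDen0 r hr ((map_eq_zero σ).1 h')
  have hNum1 : ∀ r : K, Valued.v r = 1 → Valued.v (a * r + b * c) = 1 := by
    intro r hr
    have hlt : Valued.v (b * c) < Valued.v (a * r) := by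
      rw [map_mul, map_mul, ha, hr, hvc, mul_one, one_mul]; exact lt_of_le_of_lt hb hϖlt
    rw [Valuation.map_add_eq_of_lt_left _ hlt, map_mul, ha, hr, mul_one]
  let xm : K → K := fun r => (a * r + b * c) / (σ b * r + σ a)
  have hx1 : ∀ r : K, Valued.v r = 1 → Valued.v (xm r) = 1 := fun r hr => by
    simp only [xm]; rw [map_div₀, hNum1 r hr, hDen1 r hr, div_one]
  have hσx : ∀ r : K, σ (xm r) = (σ a * σ r + σ b * c) / (b * σ r + a) := fun r => by
    simp only [xm]; rw [map_div₀, map_add, map_add, map_mul, map_mul, map_mul, hσ, hσ, hσc]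
  -- the exact identities at `r`
  have hI : ∀ r : K, Valued.v r = 1 → xm r * σ (xm r) - c = Nrd * (r * σ r - c) / ((σ b * r + σ a) * (b * σ r + a)) := by
    intro r hr
    rw [hσx]; simp only [xm]
    rw [hNrd]
    exact mobius_norm_identity (a := a) (as := σ a) (b := b) (bs := σ b) (c := c) (r := r) (rs := σ r) (hDen0 r hr) (hDen0' r hr)
  -- the representative map `Φ r := rep(x r)`
  have hrep : ∀ r ∈ Ru, ∃ r' ∈ R, Valued.v (xm r - r') ≤ Valued.v ϖ ^ s := fun r hr =>
    hR₂ _ (hx1 r (Finset.mem_filter.1 hr).2).le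
  choose! Φ hΦR hΦ using hrep
  have hsmall : Valued.v ϖ ^ s < 1 := by
    rw [hϖ, ← exp_nsmul, nsmul_eq_mul, mul_neg, mul_one, ← exp_zero]; exact exp_lt_exp.2 (by omega)
  have hΦ1 : ∀ r ∈ Ru, Valued.v (Φ r) = 1 := by
    intro r hr
    have hr1 := (Finset.mem_filter.1 hr).2
    have hlt : Valued.v (Φ r - xm r) < Valued.v (xm r) := by
      rw [hx1 r hr1, ← Valuation.map_neg, neg_sub]; exact lt_of_le_of_lt (hΦ r hr) hsmall
    rw [show Φ r = xm r + (Φ r - xm r) by ring, Valuation.map_add_eq_of_lt_left _ hlt, hx1 r hr1]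
  have hΦRu : ∀ r ∈ Ru, Φ r ∈ Ru := fun r hr => Finset.mem_filter.2 ⟨hΦR r hr, hΦ1 r hr⟩
  -- `N(Φ r)` is `ϖ^s`-close to `N(x r)`
  have hNΦ : ∀ r ∈ Ru, Valued.v (Φ r * σ (Φ r) - xm r * σ (xm r)) ≤ Valued.v ϖ ^ s := by
    intro r hr
    have hr1 := (Finset.mem_filter.1 hr).2
    have hxle : Valued.v (xm r) ≤ 1 := (hx1 r hr1).le
    set δ := Φ r - xm r with hδ
    have hvδ : Valued.v δ ≤ Valued.v ϖ ^ s := by rw [hδ, ← Valuation.map_neg, neg_sub]; exact hΦ r hr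
    have e2 : Φ r * σ (Φ r) - xm r * σ (xm r) = xm r * σ δ + σ (xm r) * δ + δ * σ δ := by
      rw [show Φ r = xm r + δ by rw [hδ]; ring, map_add]; ring
    rw [e2]
    refine (Valuation.map_add _ _ _).trans (max_le ((Valuation.map_add _ _ _).trans (max_le ?_ ?_)) ?_)
    · rw [map_mul, hvσ]; exact (mul_le_of_le_one_left' hxle).trans hvδ
    · rw [map_mul, hvσ]; exact (mul_le_of_le_one_left' hxle).trans hvδ
    · rw [map_mul, hvσ]; exact (mul_le_of_le_one_right' (hvδ.trans (pow_le_one₀ zero_le hϖ1))).trans hvδ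
  -- THE FLIP `ω(y(Φ r)) = −ω(y r)`
  have hflipr : ∀ r ∈ Ru, normSign σ (C₀ + C₁ * (Φ r * σ (Φ r))) = -normSign σ (C₀ + C₁ * (r * σ r)) := by
    intro r hr
    have hr1 := (Finset.mem_filter.1 hr).2
    have hND : (σ b * r + σ a) * (b * σ r + a) ≠ 0 := mul_ne_zero (hDen0 r hr1) (hDen0' r hr1)
    have hNDσ : σ ((σ b * r + σ a) * (b * σ r + a)) = (σ b * r + σ a) * (b * σ r + a) := by
      simp only [map_mul, map_add, hσ]; ring
    have hNDnorm : ∃ z : K, z * σ z = (σ b * r + σ a) * (b * σ r + a) :=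
      ⟨σ b * r + σ a, by simp only [map_add, map_mul, hσ]⟩
    -- the exact value `w := C₀ + C₁ N(x r) = (Nrd ∕ N(D)) · y r`
    set w : K := C₀ + C₁ * (xm r * σ (xm r)) with hwdef
    have hwexact : w = Nrd / ((σ b * r + σ a) * (b * σ r + a)) * (C₀ + C₁ * (r * σ r)) := by
      rw [hwdef, hy r, show C₀ + C₁ * (xm r * σ (xm r)) = C₁ * (xm r * σ (xm r) - c) by rw [hc]; field_simp; ring, hI r hr1]
      field_simp
    have hσw : σ w = w := by rw [hwdef, map_add, hσC₀, map_mul, hσC₁, map_mul, hσ, mul_comm (σ (xm r))]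
    have hw0 : w ≠ 0 := by rw [hwexact]; exact mul_ne_zero (div_ne_zero hNrd0 hND) (hy0 r hr1)
    have hvw : Valued.v ϖ ^ (2 * d - 2) ≤ Valued.v w := by
      rw [hwexact, map_mul, map_div₀, hvNrd, map_mul, hDen1 r hr1, ← hvσ (b * σ r + a),
        show σ (b * σ r + a) = σ b * r + σ a by rw [map_add, map_mul, hσ], hDen1 r hr1, mul_one, div_one, one_mul, hy, map_mul, hC₁, one_mul]
      exact hfar r hr1
    have hωw : normSign σ w = -normSign σ (C₀ + C₁ * (r * σ r)) := by
      rw [hwexact, normSign_mul_of_fixed hD (by rw [map_div₀, hσNrd, hNDσ]) (hσy r) (div_ne_zero hNrd0 hND) (hy0 r hr1),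
        div_eq_mul_inv, normSign_mul_of_fixed hD hσNrd (by rw [map_inv₀, hNDσ]) hNrd0 (inv_ne_zero hND), normSign_of_not_isNorm σ hnrd']
      have hinv : normSign σ ((σ b * r + σ a) * (b * σ r + a))⁻¹ = 1 := by
        obtain ⟨z, hz⟩ := hNDnorm
        refine normSign_of_isNorm σ ⟨z⁻¹, ?_⟩
        rw [map_inv₀, ← mul_inv, hz]
      rw [hinv]; ring
    -- the actual value is `w · u` with `u ∈ U_F(2d−1)`
    have hdiff : C₀ + C₁ * (Φ r * σ (Φ r)) = w * (1 + C₁ * (Φ r * σ (Φ r) - xm r * σ (xm r)) / w) := by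
      rw [mul_add, mul_one, mul_div_cancel₀ _ hw0, hwdef]; ring
    have hσu : σ (1 + C₁ * (Φ r * σ (Φ r) - xm r * σ (xm r)) / w) = 1 + C₁ * (Φ r * σ (Φ r) - xm r * σ (xm r)) / w := by
      rw [map_add, map_one, map_div₀, map_mul, hσC₁, map_sub, hNσ, map_mul, hσ, mul_comm (σ (xm r)), hσw]
    have hu : Valued.v (1 + C₁ * (Φ r * σ (Φ r) - xm r * σ (xm r)) / w - 1) ≤ Valued.v ϖ ^ (2 * d - 1) := by
      rw [add_sub_cancel_left, map_div₀, map_mul, hC₁, one_mul]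
      have hw' : 0 < Valued.v w := lt_of_lt_of_le (pow_pos (lt_of_le_of_ne zero_le hϖ0'.symm) _) hvw
      rw [div_le_iff₀ hw']
      calc Valued.v (Φ r * σ (Φ r) - xm r * σ (xm r)) ≤ Valued.v ϖ ^ s := hNΦ r hr
        _ ≤ Valued.v ϖ ^ (2 * d - 1 + (2 * d - 2)) := pow_le_pow_right_of_le_one' hϖ1 (by omega)
        _ = Valued.v ϖ ^ (2 * d - 1) * Valued.v ϖ ^ (2 * d - 2) := pow_add _ _ _
        _ ≤ Valued.v ϖ ^ (2 * d - 1) * Valued.v w := mul_le_mul' le_rfl hvw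
    rw [hdiff, normSign_mul_eq_of_fixed_of_v_sub_one_le hD w hσu le_rfl hu, hωw]
  -- `Φ` is injective on `Ru` (the Möbius map is an isometry on the units), hence a bijection; summing the flip gives `Σ = −Σ`
  have hinj : ∀ r₁ ∈ Ru, ∀ r₂ ∈ Ru, Φ r₁ = Φ r₂ → r₁ = r₂ := by
    intro r₁ hr₁ r₂ hr₂ heq
    have h1 := (Finset.mem_filter.1 hr₁).2; have h2 := (Finset.mem_filter.1 hr₂).2
    refine hR₃ r₁ (Finset.mem_filter.1 hr₁).1 r₂ (Finset.mem_filter.1 hr₂).1 ?_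
    have hdlt : Valued.v (xm r₁ - xm r₂) ≤ Valued.v ϖ ^ s := by
      rw [show xm r₁ - xm r₂ = (xm r₁ - Φ r₁) - (xm r₂ - Φ r₂) by rw [heq]; ring]
      exact (Valuation.map_sub _ _ _).trans (max_le (hΦ r₁ hr₁) (hΦ r₂ hr₂))
    have e : xm r₁ - xm r₂ = Nrd * (r₁ - r₂) / ((σ b * r₁ + σ a) * (σ b * r₂ + σ a)) := by
      simp only [xm]; rw [hNrd]; exact mobius_sub_identity (hDen0 r₁ h1) (hDen0 r₂ h2)
    rw [e, map_div₀, map_mul, hvNrd, one_mul, map_mul, hDen1 r₁ h1, hDen1 r₂ h2, mul_one, div_one] at hdlt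
    exact hdlt
  have hsum : ∑ r ∈ Ru, normSign σ (C₀ + C₁ * (Φ r * σ (Φ r))) = ∑ r ∈ Ru, normSign σ (C₀ + C₁ * (r * σ r)) :=
    Finset.sum_bij (fun r _ => Φ r) (fun r hr => hΦRu r hr) (fun r₁ hr₁ r₂ hr₂ h => hinj r₁ hr₁ r₂ hr₂ h)
      (fun r' hr' => by
        have himg : Ru.image Φ = Ru := Finset.eq_of_subset_of_card_le (Finset.image_subset_iff.2 fun r hr => hΦRu r hr)
          (by rw [Finset.card_image_of_injOn (fun r₁ hr₁ r₂ hr₂ h => hinj r₁ hr₁ r₂ hr₂ h)])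
        have hr'' : r' ∈ Ru.image Φ := by rw [himg]; exact hr'
        obtain ⟨r, hr, hrr'⟩ := Finset.mem_image.1 hr''
        exact ⟨r, hr, hrr'⟩)
      (fun _ _ => rfl)
  have hneg : ∑ r ∈ Ru, normSign σ (C₀ + C₁ * (Φ r * σ (Φ r))) = -∑ r ∈ Ru, normSign σ (C₀ + C₁ * (r * σ r)) := by
    rw [← Finset.sum_neg_distrib]; exact Finset.sum_congr rfl hflipr
  have h2 : (2 : ℤ) * ∑ r ∈ Ru, normSign σ (C₀ + C₁ * (r * σ r)) = 0 := by linarith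
  simpa using h2

end Summit.HodgeConjecture.HodgeConjecture.Cruxes.H413.F0P3cDyRamBinaryNormFormConicAnisotropic

end
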